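import Mathlib
import Literature.Barriers.ValiantsHypothesis.AlgebraicNaturalProofs
import Literature.Computability.AlgebraicComplexity.ArithCircuitProofs
import Summits.ValiantsHypothesis.ValiantsHypothesis.Theorems.BarrierLeverSuccinctHittingSetsForVPStubFullSupport
import Summits.ValiantsHypothesis.ValiantsHypothesis.Theorems.DivisionGapPerDivisionHardStubJssContractionB

/-!
# Crux `BarrierLever.DefinableEquations` (stmt-ValiantsHypothesis-8745) — the b = 2 test battery:
# a FULL-SUPPORT member of `SmallCircuits ℂ n 2`, hence no monomial equation at the first open rung
# (lead c8, `--supports`)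

The first open rung of the crux (equivalently of the support item `SingleSizeEquations`,
stmt-ValiantsHypothesis-8749) is `b = 2`: a nonzero boolean-sum equation vanishing at `coeff(f)`
for every `f` of degree `≤ n` and fan-in-two size `≤ n²`.  Lead c3's rung `b ≤ 1` is closed by a
single MONOMIAL in the coefficient variables (`∏_j c_{x_jⁿ}`, `definableEquations_rungOne`), and
lead c4's standing battery (`…StatusTestsAtTwo`) lists members of `SmallCircuits ℂ n 2` that every
candidate equation at `b = 2` must vanish on.  This file adds the member that kills the whole class
of monomial (support-pattern) equations at `b = 2`:

* `linearFormPow_mem_smallCircuits_two` : for `n ≥ 8`, `(1 + x₁ + ⋯ + x_n)ⁿ ∈ SmallCircuits ℂ n 2`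
  — size `≤ (n - 3)(n + 3) ≤ n²` by repeated squaring (`complexity_pow_le_log`, the sharing-aware
  squaring gate `JssContraction.complexity_mul_self_le`), versus the `n (n + 2) ≤ n³` of the sibling
  crux's `FullSupport.complexity_linearForm_pow_le`;
* `exists_fullSupport_mem_smallCircuits_two` : for `n ≥ 8` some `f ∈ SmallCircuits ℂ n 2` has ALL
  `C(2n,n)` coefficients on `degLEMonomials n` nonzero (`FullSupport.coeff_linearForm_pow_ne_zero`);
* `monomial_not_equation_two` : consequently NO monomial `c^d` (times a nonzero scalar) vanishes on
  `coeff(SmallCircuits ℂ n 2)`, `n ≥ 8` — every equation at the rung `b = 2`, in particular every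
  witness `boolSum H` of the crux there, has at least two monomials (`two_le_card_support_of_equation_two`).

No new definitions, no named facts; elementary.
-/

set_option linter.dupNamespace false

noncomputable section

namespace Summit.ValiantsHypothesis.ValiantsHypothesis.Theorems.BarrierLeverDefinableEquations

open MvPolynomial
open Literature.Computability.AlgebraicComplexity Literature.Barriers.ValiantsHypothesis
open scoped BigOperators

namespace FullSupportAtTwo

/-- **Repeated squaring in the tree's model**: `L(f^d) ≤ T · (L(f) + 2)` whenever `d < 2^T`
(one squaring gate reading its operand twice, `JssContraction.complexity_mul_self_le`, plus one
multiplication by `f` per binary digit). [folklore] -/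
theorem complexity_pow_le_log {k : Type*} [CommSemiring k] {σ : Type*} (f : MvPolynomial σ k)
    (T : ℕ) : ∀ d : ℕ, d < 2 ^ T → complexity (f ^ d) ≤ T * (complexity f + 2) := by
  induction T with
  | zero =>
    intro d hd
    have hd0 : d = 0 := by omega
    rw [hd0, pow_zero, ← C_1, complexity_C_holds]
    exact Nat.zero_le _
  | succ T ih =>
    intro d hd
    have hhalf : d / 2 < 2 ^ T := by rw [pow_succ] at hd; omega
    have hsplit : f ^ d = f ^ (d / 2) * f ^ (d / 2) * f ^ (d % 2) := by
      rw [← pow_add, ← pow_add]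
      congr 1
      omega
    have hbit : complexity (f ^ (d % 2)) ≤ complexity f := by
      rcases Nat.mod_two_eq_zero_or_one d with h | h
      · rw [h, pow_zero, ← C_1, complexity_C_holds]; exact Nat.zero_le _
      · rw [h, pow_one]
    rw [hsplit]
    calc complexity (f ^ (d / 2) * f ^ (d / 2) * f ^ (d % 2))
        ≤ complexity (f ^ (d / 2) * f ^ (d / 2)) + complexity (f ^ (d % 2)) + 1 :=
          complexity_mul_le_holds _ _
      _ ≤ (complexity (f ^ (d / 2)) + 1) + complexity f + 1 :=
          Nat.add_le_add_right (Nat.add_le_add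
            (Summit.ValiantsHypothesis.ValiantsHypothesis.Theorems.DivisionGapPerDivisionHard.JssContraction.complexity_mul_self_le _)
            hbit) 1
      _ ≤ (T * (complexity f + 2) + 1) + complexity f + 1 := by
          have := ih (d / 2) hhalf
          omega
      _ = (T + 1) * (complexity f + 2) := by ring

/-- Arithmetic: `n < 2^(n-3)` for `n ≥ 8`. [folklore] -/
theorem lt_two_pow_sub_three {n : ℕ} (hn : 8 ≤ n) : n < 2 ^ (n - 3) := by
  obtain ⟨j, rfl⟩ : ∃ j, n = j + 8 := ⟨n - 8, by omega⟩
  have hj : j < 2 ^ j := Nat.lt_two_pow_self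
  have h : j + 8 - 3 = j + 5 := by omega
  rw [h, pow_add]
  have h32 : (2 : ℕ) ^ 5 = 32 := by norm_num
  rw [h32]
  omega

open Summit.ValiantsHypothesis.ValiantsHypothesis.Theorems.BarrierLever.SuccinctHittingSetsForVP.FullSupport in
/-- **`(1 + x₁ + ⋯ + x_n)ⁿ` is a size-`n²` circuit** for `n ≥ 8`: `L ≤ (n-3)(L(1 + Σ x_i) + 2) ≤
(n-3)(n+3) ≤ n²` by repeated squaring with `T = n - 3` digits (`n < 2^(n-3)`), and `deg ≤ n`.
[folklore] -/
theorem linearFormPow_mem_smallCircuits_two {n : ℕ} (hn : 8 ≤ n) :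
    ((1 + ∑ i : Fin n, X i : MvPolynomial (Fin n) ℂ) ^ n) ∈ SmallCircuits ℂ n 2 := by
  refine ⟨totalDegree_linearForm_pow_le n, ?_⟩
  have hL := complexity_pow_le_log (1 + ∑ i : Fin n, X i : MvPolynomial (Fin n) ℂ) (n - 3) n
    (lt_two_pow_sub_three hn)
  have hlin : complexity (1 + ∑ i : Fin n, X i : MvPolynomial (Fin n) ℂ) ≤ n + 1 :=
    complexity_linearForm_le
  calc complexity ((1 + ∑ i : Fin n, X i : MvPolynomial (Fin n) ℂ) ^ n)
      ≤ (n - 3) * (complexity (1 + ∑ i : Fin n, X i : MvPolynomial (Fin n) ℂ) + 2) := hL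
    _ ≤ (n - 3) * (n + 3) := Nat.mul_le_mul_left _ (by omega)
    _ ≤ n ^ 2 := by
        obtain ⟨j, rfl⟩ : ∃ j, n = j + 3 := ⟨n - 3, by omega⟩
        rw [Nat.add_sub_cancel]
        nlinarith

open Summit.ValiantsHypothesis.ValiantsHypothesis.Theorems.BarrierLever.SuccinctHittingSetsForVP.FullSupport in
/-- **A full-support member of `SmallCircuits ℂ n 2`** (`n ≥ 8`): all `C(2n,n)` coefficients of
`(1 + x₁ + ⋯ + x_n)ⁿ` at monomials of degree `≤ n` are nonzero (positive multinomials).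
[folklore] -/
theorem exists_fullSupport_mem_smallCircuits_two {n : ℕ} (hn : 8 ≤ n) :
    ∃ f ∈ SmallCircuits ℂ n 2, ∀ m : degLEMonomials n, coeff (m : Fin n →₀ ℕ) f ≠ 0 :=
  ⟨_, linearFormPow_mem_smallCircuits_two hn, fun m => coeff_linearForm_pow_ne_zero n m.1 m.2⟩

/-- **No monomial equation at the rung `b = 2`** (`n ≥ 8`): for every exponent `d` on the
coefficient variables and every scalar `r ≠ 0`, the monomial `r · c^d` is nonzero at the
coefficient vector of some `f ∈ SmallCircuits ℂ n 2` (the full-support member). [folklore] -/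
theorem monomial_not_equation_two {n : ℕ} (hn : 8 ≤ n) (d : ↥(degLEMonomials n) →₀ ℕ) {r : ℂ}
    (hr : r ≠ 0) :
    ∃ f ∈ SmallCircuits ℂ n 2, eval (coeffVector (degLEMonomials n) f) (monomial d r) ≠ 0 := by
  obtain ⟨f, hf, hfull⟩ := exists_fullSupport_mem_smallCircuits_two hn
  refine ⟨f, hf, ?_⟩
  rw [eval_monomial]
  refine mul_ne_zero hr ?_
  rw [Finsupp.prod]
  exact Finset.prod_ne_zero_iff.mpr fun m _ => pow_ne_zero _ (by simpa using hfull m)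

/-- **Every equation at the rung `b = 2` has at least two monomials** (`n ≥ 8`): a nonzero
polynomial in the coefficient variables vanishing at `coeff(f)` for all `f ∈ SmallCircuits ℂ n 2`
has `card support ≥ 2`.  Applies verbatim to every witness `E = boolSum H` of the crux
`DefinableEquations` / `SingleSizeEquations` at `b = 2` (compare lead c4's
`lt_card_support_of_vanishes_on_smallCircuits`: every monomial of such an `E` meets `> n/2 - 1`
coordinates). [folklore] -/
theorem two_le_card_support_of_equation_two {n : ℕ} (hn : 8 ≤ n)
    {E : MvPolynomial (degLEMonomials n) ℂ} (hE0 : E ≠ 0)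
    (hE : ∀ f ∈ SmallCircuits ℂ n 2, eval (coeffVector (degLEMonomials n) f) E = 0) :
    2 ≤ E.support.card := by
  classical
  by_contra hlt
  push Not at hlt
  have hne : E.support.Nonempty := by
    rw [Finset.nonempty_iff_ne_empty, Ne, MvPolynomial.support_eq_empty]
    exact hE0
  obtain ⟨d, hd⟩ : ∃ d, E.support = {d} := by
    have hcard : E.support.card = 1 := by
      have := Finset.card_pos.mpr hne
      omega
    exact Finset.card_eq_one.mp hcard
  have hEq : E = monomial d (coeff d E) := by
    refine MvPolynomial.ext _ _ fun m => ?_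
    rw [coeff_monomial]
    split_ifs with h
    · rw [h]
    · have : m ∉ E.support := by rw [hd]; simpa [Finset.mem_singleton] using Ne.symm h
      simpa [MvPolynomial.mem_support_iff] using this
  have hr : coeff d E ≠ 0 := by
    have : d ∈ E.support := by rw [hd]; exact Finset.mem_singleton_self d
    exact MvPolynomial.mem_support_iff.mp this
  obtain ⟨f, hf, hne'⟩ := monomial_not_equation_two hn d hr
  exact hne' (hEq ▸ hE f hf)

end FullSupportAtTwo

/-! ## Registered sub-goal (signature verbatim as registered on stmt-ValiantsHypothesis-8745) -/

/-- **Registered sub-goal `two_le_card_support_of_equation_two`** (crux stmt-ValiantsHypothesis-8745,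
line `registered`, lead c8; b = 2 test battery): for `n ≥ 8`, every nonzero polynomial in the
`C(2n,n)` coefficient variables vanishing at `coeff(f)` for all `f ∈ SmallCircuits ℂ n 2` has at
least two monomials — no monomial equation exists at the first open rung. [folklore] -/
theorem two_le_card_support_of_equation_two :
    ∀ n : ℕ, 8 ≤ n → ∀ E : MvPolynomial ↥(Literature.Barriers.ValiantsHypothesis.degLEMonomials n) ℂ, E ≠ 0 → (∀ f ∈ Literature.Barriers.ValiantsHypothesis.SmallCircuits ℂ n 2, MvPolynomial.eval (Literature.Barriers.ValiantsHypothesis.coeffVector (Literature.Barriers.ValiantsHypothesis.degLEMonomials n) f) E = 0) → 2 ≤ E.support.card :=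
  fun _ hn _ hE0 hE => FullSupportAtTwo.two_le_card_support_of_equation_two hn hE0 hE

end Summit.ValiantsHypothesis.ValiantsHypothesis.Theorems.BarrierLeverDefinableEquations

end
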